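import Literature.AlgebraicGeometry.FundamentalGroup.HypersurfaceComplementMeridiansConj
import Literature.AlgebraicGeometry.FundamentalGroup.HypersurfaceComplementGenericLines
import Literature.AlgebraicTopology.FundamentalGroup.LineSliceLoops
import Literature.AlgebraicTopology.FundamentalGroup.PuncturedPlaneLassoGenerators
import HarnessLib

/-!
# The fundamental group of the complement of an affine hypersurface is normally generated by
# meridians (Zariski–van Kampen generation) — discharge of
# `affineHypersurfaceComplement_meridians_normalClosure_eq_top`

Topic `Literature/AlgebraicGeometry/FundamentalGroup`.  The named fact
`affineHypersurfaceComplement_meridians_normalClosure_eq_top` of `HypersurfaceComplementMeridians`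
(Shimada 2010, Prop. 3.4 for `M = ℂ^ι`; Deligne, Weil I (5.2); Carlson–Toledo 1999 §3: for
irreducible `h₁, …, hₘ ∈ ℂ[xᵢ : i ∈ ι]`, `U = ℂ^ι ∖ ⋃ V(hⱼ)`, `s ∈ U` and ONE meridian `μⱼ` of each
`V(hⱼ)` based at `s`, the normal closure of `{μ₁, …, μₘ}` is `π₁(U, s)`) is PROVED:
**`affineHypersurfaceComplement_meridians_normalClosure_eq_top_holds`**.

## Proof (no transversality theory, no Zariski hyperplane theorem)

1. (`HypersurfaceComplementGenericLines`, algebra) At a generic base point `b ∈ U` — Baire over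
   resultants — every complex line `c ↦ b + c v`, `v` in a countable dense set `S` of directions,
   meets `H` in SIMPLE roots lying on single components (`LineGood`).
2. (`LineSliceLoops`, topology) `π₁(U, b)` is generated by the images of the fundamental groups of
   the punctured lines `Λ_z = {c | b + c(z - b) ∈ U}`, `z ∈ b + S` (line subdivision of a loop).
3. (`PuncturedPlaneLassoGenerators`) `π₁(Λ_z, 0)`, a plane minus finitely many points, is the
   normal closure of one lasso per puncture; along a GOOD line the image in `U` of such a lasso is
   the loop of a tree `Meridian` (`meridianOfLasso`: the puncture is a simple root on exactly one
   component — the transversality and the "no other component" fields of `Meridian`).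
   Hence the classes of ALL meridians based at `b` normally generate `π₁(U, b)`
   (`normalClosure_meridianClasses_eq_top_of_lineGood`).
4. Transport to the given base point `s` along a path of `U` (`U` is path connected,
   `MeridianConj.isPathConnected_affineHypersurfaceComplement`; prepend the path to the leashes),
   and replace every meridian of `V(hⱼ)` by the given `μⱼ` up to conjugacy — the meridian conjugacy
   theorem `affineHypersurfaceComplement_meridian_isConj_holds` (`HypersurfaceComplementMeridiansConj`).

Everything is proved; the only definitions are the plumbing `Meridian.precomp` (prepend a path to
the leash) and `meridianOfLasso`.

## References

* I. Shimada, *Generalized Zariski–van Kampen theorem and its application to Grassmannian dual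
  varieties*, Int. J. Math. 21 (2010), §3 Prop. 3.4. [Shimada2010ZvK]
* P. Deligne, *La conjecture de Weil. I*, Publ. Math. IHÉS 43 (1974), (5.2). [Deligne1974]
* J. A. Carlson, D. Toledo, Duke Math. J. 97 (1999), §3. [CarlsonToledo1999]
* C. Voisin, *Hodge Theory and Complex Algebraic Geometry II* (2003), §3.2.2. [VoisinHodgeII2003]
-/

noncomputable section

open Set Function unitInterval
open Literature.AlgebraicTopology.FundamentalGroup

namespace Literature.AlgebraicGeometry.FundamentalGroup

variable {ι : Type} [Fintype ι] {m : ℕ} {h : Fin m → MvPolynomial ι ℂ}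

/-! ### Meridians: change of base point, the set of all meridian classes -/

namespace Meridian

variable {s s' : affineHypersurfaceComplement h} {j : Fin m}

/-- Prepending a path `s' ⇝ s` of `U` to the leash moves the base point of a meridian.
[cite: Shimada2010ZvK, §3 (leashed discs: the leash `η`)] -/
def precomp (p : Path s' s) (μ : Meridian h s j) : Meridian h s' j where
  y := μ.y
  v := μ.v
  ε := μ.ε
  ε_pos := μ.ε_pos
  eval_center := μ.eval_center
  eval_center_ne := μ.eval_center_ne
  transversal := μ.transversal
  discPoint_mem := μ.discPoint_mem
  leashEnd_mem := μ.leashEnd_mem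
  leash := p.trans μ.leash

/-- **Change of base point for meridians**: the transport `c ↦ [p · c · p⁻¹]` along `p : s' ⇝ s`
sends the class of a meridian to the class of the meridian with the prepended leash.
[cite: HatcherAT2002, §1.1 Prop. 1.5 (change of base point)] -/
theorem pathConj_loopClass (p : Path s' s) (μ : Meridian h s j) :
    (FundamentalGroup.fundamentalGroupMulEquivOfPath p).symm μ.loopClass = (μ.precomp p).loopClass := by
  change FundamentalGroup.fromPath (Path.Homotopic.Quotient.mk (p.trans (μ.loop.trans p.symm))) =
    FundamentalGroup.fromPath (Path.Homotopic.Quotient.mk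
      (((p.trans μ.leash).trans μ.circle).trans (p.trans μ.leash).symm))
  rw [Meridian.loop, Path.trans_symm]
  simp only [Meridian.leashEnd, Path.Homotopic.Quotient.mk_trans, Path.Homotopic.Quotient.mk_symm,
    Path.Homotopic.Quotient.trans_assoc]

end Meridian

/-- The set of the classes in `π₁(U, s)` of ALL meridians (all components, centres, directions,
radii, leashes) based at `s`. [cite: Shimada2010ZvK, §3 Prop. 3.4 (the lassos around `H₁, …, H_l`)] -/
def meridianClasses (h : Fin m → MvPolynomial ι ℂ) (s : affineHypersurfaceComplement h) :
    Set (FundamentalGroup (affineHypersurfaceComplement h) s) :=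
  {g | ∃ (j : Fin m) (μ : Meridian h s j), g = μ.loopClass}

/-! ### The slices of `U` by complex lines are complements of finitely many points -/

section Slices

/-- The parameters `c` at which the line `c ↦ b + c v` meets `H = ⋃ V(hⱼ)`. [cite: Shimada2010ZvK, §3 Prop. 3.4 (proof)] -/
def lineRoots (h : Fin m → MvPolynomial ι ℂ) (b v : ι → ℂ) : Set ℂ :=
  {c | ∃ j, MvPolynomial.eval (b + c • v) (h j) = 0}

omit [Fintype ι] in
/-- Off the base point's hypersurface the line meets `H` in finitely many points (the restriction
`c ↦ hⱼ(b + c v)` is a non-zero polynomial, `hⱼ(b) ≠ 0`). [cite: Shimada2010ZvK, §3 Prop. 3.4 (proof)] -/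
theorem lineRoots_finite {b : ι → ℂ} (hb : b ∈ affineHypersurfaceComplement h) (v : ι → ℂ) :
    (lineRoots h b v).Finite := by
  have : lineRoots h b v = ⋃ j, {c | ((lineRestr v (h j)).map (MvPolynomial.eval b)).IsRoot c} := by
    ext c
    simp only [lineRoots, mem_setOf_eq, mem_iUnion, Polynomial.IsRoot.def, eval_eval_lineRestr]
  rw [this]
  refine Set.finite_iUnion fun j => Polynomial.finite_setOf_isRoot fun h0 => ?_
  have h1 := congrArg (Polynomial.eval (0 : ℂ)) h0
  rw [eval_eval_lineRestr, Polynomial.eval_zero, zero_smul, add_zero] at h1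
  exact hb j h1

/-- The slice of `U` by the line through `b` and `z` is the plane minus the roots.
[cite: Shimada2010ZvK, §3 Prop. 3.4 (proof)] -/
theorem lineSlice_eq (b z : ι → ℂ) :
    LineSlice.lineSlice (affineHypersurfaceComplement h) b z = univ \ lineRoots h b (z - b) := by
  ext c
  simp only [LineSlice.mem_lineSlice, LineSlice.linePt, mem_affineHypersurfaceComplement_iff, mem_sdiff,
    mem_univ, true_and, lineRoots, mem_setOf_eq, not_exists]

/-- Every slice through a point of `U` joins `0` to `1` (a plane minus finitely many points is
path connected). [cite: Shimada2010ZvK, §3 Prop. 3.4 (proof)] -/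
theorem joinedIn_lineSlice {b : ι → ℂ} (hb : b ∈ affineHypersurfaceComplement h) {z : ι → ℂ}
    (hz : z ∈ affineHypersurfaceComplement h) :
    JoinedIn (LineSlice.lineSlice (affineHypersurfaceComplement h) b z) 0 1 := by
  rw [lineSlice_eq]
  have h0 : (0 : ℂ) ∈ univ \ lineRoots h b (z - b) := by
    rw [← lineSlice_eq]; exact LineSlice.zero_mem_lineSlice hb z
  have h1 : (1 : ℂ) ∈ univ \ lineRoots h b (z - b) := by
    rw [← lineSlice_eq, LineSlice.mem_lineSlice, LineSlice.linePt_one]; exact hz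
  exact (isPathConnected_convex_diff_finite convex_univ isOpen_univ (lineRoots_finite hb _) ⟨0, h0⟩).joinedIn
    0 h0 1 h1

end Slices

/-! ### Along a good line, lassos of the slice are meridians -/

section GoodLine

variable {b : ι → ℂ} (hb : b ∈ affineHypersurfaceComplement h) (z : ι → ℂ)

/-- `b + (r + c) v = (b + r v) + c v`: the disc of the slice around `r`, read in `ℂ^ι`, is the
straight disc through `y = b + r v` in the direction `v`. [folklore] -/
private theorem linePt_add (r c : ℂ) :
    LineSlice.linePt b z (r + c) = discPoint (b + r • (z - b)) (z - b) c := by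
  simp only [LineSlice.linePt, discPoint, add_smul, add_assoc]

/-- **The meridian of a lasso along a good line.**  Let the line through `b ∈ U` and `z` be good
(`LineGood h b (z - b)`), and let `L` be a lasso of its slice around a root `r` (a puncture).
Then the image of `L` in `U` is a meridian: centre `y = b + r(z - b)` on the component `V(hⱼ)`
through it (and on no other, by goodness), direction `z - b` (transversal: `r` is a simple root),
radius that of `L`, leash the image of the leash. [cite: Shimada2010ZvK, §3 Prop. 3.4 (proof: lassos of transversal discs)] -/
def meridianOfLasso (hgood : LineGood h b (z - b)) {r : ℂ} {j : Fin m}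
    (hr : MvPolynomial.eval (b + r • (z - b)) (h j) = 0)
    (L : PlanarLasso (LineSlice.lineSlice (affineHypersurfaceComplement h) b z)
      ⟨0, LineSlice.zero_mem_lineSlice hb z⟩ r) :
    Meridian h ⟨b, hb⟩ j where
  y := b + r • (z - b)
  v := z - b
  ε := L.ε
  ε_pos := L.ε_pos
  eval_center := hr
  eval_center_ne i hij := (hgood j r hr).2 i hij
  transversal := (hgood j r hr).1
  discPoint_mem c hc hle := by
    rw [← linePt_add]; exact L.mem c hc hle
  leashEnd_mem := by
    rw [← linePt_add]; exact L.leashEnd_mem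
  leash := (L.leash.map (LineSlice.lineIncl (affineHypersurfaceComplement h) b z).continuous).cast
    (LineSlice.lineIncl_zero hb z).symm (Subtype.ext (linePt_add z r L.ε).symm)

/-- The leash of the meridian of a lasso is the image of the leash. [cite: Shimada2010ZvK, §3 Prop. 3.4 (proof)] -/
theorem meridianOfLasso_leash_apply (hgood : LineGood h b (z - b)) {r : ℂ} {j : Fin m}
    (hr : MvPolynomial.eval (b + r • (z - b)) (h j) = 0)
    (L : PlanarLasso (LineSlice.lineSlice (affineHypersurfaceComplement h) b z)
      ⟨0, LineSlice.zero_mem_lineSlice hb z⟩ r) (u : I) :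
    ((meridianOfLasso hb z hgood hr L).leash u : ι → ℂ) = LineSlice.linePt b z (L.leash u : ℂ) := rfl

/-- The circle of the meridian of a lasso is the image of the circle. [cite: Shimada2010ZvK, §3 Prop. 3.4 (proof)] -/
theorem meridianOfLasso_circlePoint (hgood : LineGood h b (z - b)) {r : ℂ} {j : Fin m}
    (hr : MvPolynomial.eval (b + r • (z - b)) (h j) = 0)
    (L : PlanarLasso (LineSlice.lineSlice (affineHypersurfaceComplement h) b z)
      ⟨0, LineSlice.zero_mem_lineSlice hb z⟩ r) (u : I) :
    (meridianOfLasso hb z hgood hr L).circlePoint u = LineSlice.linePt b z (circlePt r L.ε u) := by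
  rw [circlePt, linePt_add]
  rfl

/-- The loop of the meridian of a lasso is the image of the loop of the lasso.
[cite: Shimada2010ZvK, §3 Prop. 3.4 (proof: lassos of transversal discs)] -/
theorem meridianOfLasso_loop_apply (hgood : LineGood h b (z - b)) {r : ℂ} {j : Fin m}
    (hr : MvPolynomial.eval (b + r • (z - b)) (h j) = 0)
    (L : PlanarLasso (LineSlice.lineSlice (affineHypersurfaceComplement h) b z)
      ⟨0, LineSlice.zero_mem_lineSlice hb z⟩ r) (t : I) :
    ((meridianOfLasso hb z hgood hr L).loop t : ι → ℂ) = LineSlice.linePt b z (L.loop t : ℂ) := by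
  simp only [Meridian.loop, PlanarLasso.loop, Path.trans_apply, Path.symm_apply]
  split_ifs with h₁ h₂
  · rfl
  · exact meridianOfLasso_circlePoint hb z hgood hr L _
  · rfl

/-- **The image of the lasso is the loop of its meridian**: `(J_z)_* [L] = [meridianOfLasso L]`.
[cite: Shimada2010ZvK, §3 Prop. 3.4 (proof: lassos of transversal discs)] -/
theorem lineInclHom_loopClass (hgood : LineGood h b (z - b)) {r : ℂ} {j : Fin m}
    (hr : MvPolynomial.eval (b + r • (z - b)) (h j) = 0)
    (L : PlanarLasso (LineSlice.lineSlice (affineHypersurfaceComplement h) b z)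
      ⟨0, LineSlice.zero_mem_lineSlice hb z⟩ r) :
    LineSlice.lineInclHom (affineHypersurfaceComplement h) hb z L.loopClass =
      (meridianOfLasso hb z hgood hr L).loopClass := by
  rw [LineSlice.lineInclHom, PlanarLasso.loopClass, FundamentalGroup.mapOfEq_apply,
    ← Path.Homotopic.Quotient.mk_map, ← Path.Homotopic.Quotient.mk_cast]
  change FundamentalGroup.fromPath (Path.Homotopic.Quotient.mk _) =
    FundamentalGroup.fromPath (Path.Homotopic.Quotient.mk _)
  congr 2
  apply Path.ext
  funext t
  apply Subtype.ext
  rw [Path.cast_coe, Path.map_coe, Function.comp_apply, LineSlice.coe_lineIncl_apply,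
    meridianOfLasso_loop_apply]

/-- Transport of the planar generation theorem to a set EQUAL to a plane minus finitely many
points (the slice). [cite: HatcherAT2002, §1.2 Example 1.21 ff.] -/
private theorem normalClosure_eq_top_of_eq_univ_diff {Y R : Set ℂ} (hR : R.Finite) (hY : Y = univ \ R)
    (x : Y) (L : ∀ a ∈ R, PlanarLasso Y x a) :
    Subgroup.normalClosure {g | ∃ (a : ℂ) (ha : a ∈ R), g = (L a ha).loopClass} = ⊤ := by
  subst hY
  exact normalClosure_eq_top_of_lassos_univ hR x L

/-- Existence of lassos in a set EQUAL to a plane minus finitely many points. [cite: HatcherAT2002, §1.2 Example 1.21 ff.] -/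
private theorem nonempty_planarLasso_of_eq_univ_diff {Y R : Set ℂ} (hR : R.Finite) (hY : Y = univ \ R)
    (x : Y) {a : ℂ} (ha : a ∈ R) : Nonempty (PlanarLasso Y x a) := by
  subst hY
  exact exists_planarLasso convex_univ isOpen_univ hR (subset_univ R) x ha

/-- The image of a normal closure lies in the normal closure of the image. [folklore] -/
private theorem map_normalClosure_le' {G K : Type*} [Group G] [Group K] (f : G →* K) (S : Set G) :
    (Subgroup.normalClosure S).map f ≤ Subgroup.normalClosure (f '' S) := by
  rw [Subgroup.map_le_iff_le_comap]
  exact Subgroup.normalClosure_le_normal fun g hg =>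
    Subgroup.subset_normalClosure (Set.mem_image_of_mem f hg)

/-- **Along a good line, the image of `π₁` of the slice lies in the normal closure of the meridian
classes**: `π₁(Λ_z, 0)` is the normal closure of one lasso per puncture
(`normalClosure_eq_top_of_lassos_univ`), and each lasso maps to a meridian (`lineInclHom_loopClass`).
[cite: Shimada2010ZvK, §3 Prop. 3.4 (proof)] -/
theorem range_lineInclHom_le (hgood : LineGood h b (z - b)) :
    (LineSlice.lineInclHom (affineHypersurfaceComplement h) hb z).range ≤
      Subgroup.normalClosure (meridianClasses h ⟨b, hb⟩) := by
  classical
  set Y := LineSlice.lineSlice (affineHypersurfaceComplement h) b z with hYdef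
  have hY : Y = univ \ lineRoots h b (z - b) := lineSlice_eq b z
  have hR := lineRoots_finite hb (z - b)
  let x₀ : Y := ⟨0, LineSlice.zero_mem_lineSlice hb z⟩
  -- one lasso per puncture
  have L : ∀ a ∈ lineRoots h b (z - b), PlanarLasso Y x₀ a := fun a ha =>
    (nonempty_planarLasso_of_eq_univ_diff hR hY x₀ ha).some
  have hgen := normalClosure_eq_top_of_eq_univ_diff hR hY x₀ L
  -- the image of the whole group
  rw [MonoidHom.range_eq_map, ← hgen]
  refine (map_normalClosure_le' _ _).trans (Subgroup.normalClosure_mono ?_)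
  rintro _ ⟨_, ⟨a, ha, rfl⟩, rfl⟩
  obtain ⟨j, hj⟩ := ha
  exact ⟨j, meridianOfLasso hb z hgood hj (L a ⟨j, hj⟩), lineInclHom_loopClass hb z hgood hj (L a ⟨j, hj⟩)⟩

end GoodLine

/-! ### Generation at a generic base point, transport, and the theorem -/

section Main

/-- **At a base point all of whose lines in a dense set of directions are good, the meridian
classes normally generate `π₁(U, b)`** (line subdivision `LineSlice.closure_iUnion_range_lineInclHom_eq_top`
+ `range_lineInclHom_le`). [cite: Shimada2010ZvK, §3 Prop. 3.4] -/
theorem normalClosure_meridianClasses_eq_top_of_lineGood {b : ι → ℂ}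
    (hb : b ∈ affineHypersurfaceComplement h) {S : Set (ι → ℂ)} (hS : Dense S)
    (hgood : ∀ v ∈ S, LineGood h b v) :
    Subgroup.normalClosure (meridianClasses h ⟨b, hb⟩) = ⊤ := by
  have hG : Dense ((Homeomorph.addLeft b) '' S) := by
    rw [dense_iff_closure_eq, ← (Homeomorph.addLeft b).image_closure, hS.closure_eq, image_univ]
    exact (Homeomorph.addLeft b).surjective.range_eq
  have hgen := LineSlice.closure_iUnion_range_lineInclHom_eq_top
    (isOpen_affineHypersurfaceComplement h) hb (fun z hz => joinedIn_lineSlice hb hz) hG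
  rw [eq_top_iff, ← hgen, Subgroup.closure_le]
  refine Set.iUnion₂_subset fun z hz => ?_
  obtain ⟨v, hv, rfl⟩ := hz
  refine range_lineInclHom_le hb _ ?_
  have e : (Homeomorph.addLeft b) v - b = v := by simp
  rw [e]
  exact hgood v hv

/-- **Change of base point**: if the meridian classes normally generate at `b`, they normally
generate at any `s` joined to `b` in `U`. [cite: HatcherAT2002, §1.1 Prop. 1.5] -/
theorem normalClosure_meridianClasses_eq_top_of_path {s b : affineHypersurfaceComplement h}
    (p : Path s b) (hgen : Subgroup.normalClosure (meridianClasses h b) = ⊤) :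
    Subgroup.normalClosure (meridianClasses h s) = ⊤ := by
  let e := (FundamentalGroup.fundamentalGroupMulEquivOfPath p).symm
  have himage : e '' meridianClasses h b ⊆ meridianClasses h s := by
    rintro _ ⟨_, ⟨j, μ, rfl⟩, rfl⟩
    exact ⟨j, μ.precomp p, Meridian.pathConj_loopClass p μ⟩
  rw [eq_top_iff]
  calc (⊤ : Subgroup (FundamentalGroup (affineHypersurfaceComplement h) s))
      = (⊤ : Subgroup (FundamentalGroup (affineHypersurfaceComplement h) b)).map e.toMonoidHom := by
        rw [← MonoidHom.range_eq_map]; exact (MonoidHom.range_eq_top.2 e.surjective).symm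
    _ = (Subgroup.normalClosure (meridianClasses h b)).map e.toMonoidHom := by rw [hgen]
    _ = Subgroup.normalClosure (e '' meridianClasses h b) :=
        Subgroup.map_normalClosure _ _ e.surjective
    _ ≤ Subgroup.normalClosure (meridianClasses h s) := Subgroup.normalClosure_mono himage

/-- Listed components carrying meridians are pairwise non-associated (the centre of a meridian of
`V(hⱼ)` lies on no other `V(hᵢ)`). [cite: Shimada2010ZvK, §3 (transversal discs around `Hᵢ` miss the other components)] -/
theorem not_associated_of_meridian {s : affineHypersurfaceComplement h} (μ : ∀ j, Meridian h s j)
    (i j : Fin m) (hij : i ≠ j) : ¬ Associated (h i) (h j) := by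
  rintro ⟨u, hu⟩
  have h0 := (μ j).eval_center
  rw [← hu, map_mul] at h0
  rcases mul_eq_zero.1 h0 with h1 | h1
  · exact (μ j).eval_center_ne i hij h1
  · exact ((u.isUnit.map (MvPolynomial.eval (μ j).y)).ne_zero) h1

/-- **The classes of all meridians based at `s` normally generate `π₁(U, s)`** (for irreducible
`hⱼ` admitting meridians): generic base point (`exists_generic_basePoint`), generation there, and
transport along a path of the path connected `U`. [cite: Shimada2010ZvK, §3 Prop. 3.4] -/
theorem normalClosure_meridianClasses_eq_top (hirr : ∀ j, Irreducible (h j))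
    (s : affineHypersurfaceComplement h) (μ : ∀ j, Meridian h s j) :
    Subgroup.normalClosure (meridianClasses h s) = ⊤ := by
  obtain ⟨b, hb, S, -, hSd, hgood⟩ := exists_generic_basePoint hirr (not_associated_of_meridian μ)
    (isOpen_affineHypersurfaceComplement h) ⟨s.1, s.2⟩
  have hpc := MeridianConj.isPathConnected_affineHypersurfaceComplement (h := h) fun j => (hirr j).ne_zero
  have hjoin := (hpc.joinedIn s.1 s.2 b hb).joined_subtype
  exact normalClosure_meridianClasses_eq_top_of_path hjoin.somePath
    (normalClosure_meridianClasses_eq_top_of_lineGood hb hSd hgood)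

/-- **Zariski–van Kampen generation — discharge of the named fact
`affineHypersurfaceComplement_meridians_normalClosure_eq_top`** (Shimada 2010, Prop. 3.4, for
`M = ℂ^ι`: "The kernel of the homomorphism `π₁(M ∖ H, b_M) → π₁(M, b_M)` induced by the inclusion
is generated by the homotopy classes of all lassos around `H₁, …, H_l`", together with "The homotopy
classes of lassos associated with all the leashed discs around `Hᵢ` with a fixed sign form a
conjugacy class"; Deligne, Weil I (5.2) "Ces lacets engendrent le groupe fondamental";
Carlson–Toledo §3).  For irreducible `h₁, …, hₘ`, `s ∈ U` and any meridians `μⱼ` of the `V(hⱼ)`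
based at `s`, the normal closure of `{[μ₁], …, [μₘ]}` is `π₁(U, s)`: all meridian classes normally
generate (`normalClosure_meridianClasses_eq_top`) and every meridian of `V(hⱼ)` is conjugate to
`μⱼ` (`affineHypersurfaceComplement_meridian_isConj_holds`). Relies on: nothing unproved.
[cite: Shimada2010ZvK, §3 Prop. 3.4 (arXiv 0906.1074 p. 9)]
[cite: Deligne1974, (5.2) and proof of Thm. (5.4), pp. 290–291] -/
theorem affineHypersurfaceComplement_meridians_normalClosure_eq_top_holds :
    affineHypersurfaceComplement_meridians_normalClosure_eq_top := by
  intro ι _ m h hirr s μ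
  rw [eq_top_iff, ← normalClosure_meridianClasses_eq_top hirr s μ]
  refine Subgroup.normalClosure_le_normal ?_
  rintro _ ⟨j, μ', rfl⟩
  have hconj : IsConj μ'.loopClass (μ j).loopClass :=
    affineHypersurfaceComplement_meridian_isConj_holds ι m h hirr s j μ' (μ j)
  obtain ⟨c, hc⟩ := isConj_iff.1 hconj
  have hmem : (μ j).loopClass ∈ Subgroup.normalClosure (Set.range fun j => (μ j).loopClass) :=
    Subgroup.subset_normalClosure ⟨j, rfl⟩
  have := (Subgroup.normalClosure_normal (s := Set.range fun j => (μ j).loopClass)).conj_mem _ hmem c⁻¹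
  rwa [← hc, inv_inv, ← mul_assoc, ← mul_assoc, inv_mul_cancel, one_mul, mul_assoc, inv_mul_cancel,
    mul_one] at this

end Main

end Literature.AlgebraicGeometry.FundamentalGroup
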